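import Summits.QuantumFields.BalabanUV.Beta.D1BFx.NeedleGhostBubblePointwise
import Summits.QuantumFields.BalabanUV.Beta.D1BFx.NeedleRowGlue

/-!
# `BalabanUV.Beta.D1BFx.NeedleGhostBubbleRow` — road «BF-x» for binder row D1, slot (K), END row `hGrp gN` (NEEDLES ∪ G_R), (N-2) rows
# «NT-4» ∕ «NT-5» FILE B: THE GHOST BUBBLE ROWS `h₄` (`ghCur ⊗ qA`) AND `h₅` (`qA ⊗ ghCur`) OF `NeedleRowGlue.abs_gN_row_le_of_tables` FROM ONE
# DISPLAYED BLOCK-ROW |·|-MASS LETTER OF THE GHOST LEG (the located M10 currency, `(CG n, δG)` free) + ONE SCALAR SCALING INEQUALITY —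
# `|ωgh n·cK n·cQ n|·(CG n)² ≤ k·n⁶ ⊢ h₄, h₅` with `C₄ = C₅ = k·(2·(1 + 4∕δG)²·K₄(δG∕2))`: TOLERANCE EXACTLY n⁶ GIVEN AN n-FREE `CG`

HONEST DEPENDENCY (cell records, verbatim): «continuum YM on T⁴ ⇐ BetaPertH ∧ nine spine estimates (0/9 proved); BetaPertH ⇐ (D1) ∧ (D4) ∧
CAP+tail; G-an2-4 gates asym, D1 and NE2/3/4.»  HONEST FRAMING (cell contract, verbatim): «discharging `BetaPertH` makes Bałaban's UV stability
UNCONDITIONAL — a real constructive-QFT result; it is NOT the continuum limit and NOT the Clay problem.»  THIS MODULE DISCHARGES NOTHING of the wall: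
it is [folklore] lattice bookkeeping BY NAME — FILE A's pointwise letters (`NeedleGhostBubblePointwise.abs_biBubbleTable_ghCur_qAntiAt_le` ∕
`…_qAntiAt_ghCur_le`: the legs enter only through block-row∕column |·|-masses), `GhostLeg.Ggh_symm`, the block geometry of `B6QGQLower276`
(`subset_U_image`, `sum_U`, `sum_B_const`) and `RJetProjector.dist_le_side_mul_dist_blk`, the uniform lattice sum `B4Sect5Proof.latticeSum_le`, the junction
`WindowIdentification.fullSum_eq_tsum_sub`, the base-point average `ContactCount.abs_sum_mul_le_of_convex` ∕ `Assembly.sum_uniform_resSite`.  No `def`,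
no `def … : Prop`, nothing cited, 0 sorry.  THE LEG LETTER `hM` AND THE SCALING INEQUALITY ARE DISPLAYED HYPOTHESES, RULED NOWHERE IN THIS FILE:
by owner ruling ρ-g9-28 (f) the n-free block-row mass of the scalar ghost leg (M10) is the located missing letter of row (N) — NOT minted here, not
cited here; the tree discharges `hM` today only LOSSILY (`CG ∝ n⁴` from the sup bound `GhostLeg.abs_Ggh_le`), under which the scaling letter FAILS by
`n⁸` at the pinned weights (`ωgh·cK·cQ = −4N²·a·n⁶`, owner X-d1p2-N36) — i.e. T4∕T5 are n-uniform EXACTLY IF `CG` is n-free, with no room to spare.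
Asserts nothing of Bałaban's.  Root-level binders hW ∕ hR-sockets ∕ hSX-socket ∕ D1Tel ∕ D1Rep — 0 discharged; (K) NOT closed; NOT D1, NOT `BetaPertH`,
NOT continuum, NOT Clay.

ABSOLUTE RULE (cell charter, verbatim): «No internally-minted statement may enter as a cited fact. Every hypothesis is either kernel-proved in this
package or a verbatim quotation of a PUBLISHED theorem with page reference. The manuscript(s) under audit are NOT citable for their own disputed
steps — they are the thing under adjudication; programme-internal (2001/route/tribunal) claims are never citable.»

WHY (owner d1-p2-g9 ruling ρ-g9-28 (d) «T4∕T5 (`ghCur ⊗ qA` over `Ggh`) … first refusal gan24-leaf-05 lineage», (b) «(S)+(M)+(P) … via … NO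
`BiLoc (·) u u C (δ∕n)` socket», (f) «M10 enters EXACTLY like `h12`: a displayed statement»; `NeedleRowGlue.abs_gN_row_le_of_tables` p255957 ✓ rows
`h₄`, `h₅`; leaf-04-g8's «NT-8» pattern `NeedleTadpoleRow.h₈_of_local_scaling` p256268 ✓ (one displayed scalar inequality, tolerance made explicit)).
FILE A bounds `|T₄(b+w,b)|` by `n⁻⁴ ×` block masses of `Ggh` at the needle's block; under `hM` this is `≤ 2·(CG n)²·n⁻⁴·e^{−δG·dist(blk (b+w), blk b)}`
(same for `T₅` with the two blocks exchanged); the (1.22) weight costs `(n·(dist_blk + 1))²`, the `w`-sum `n⁴` per block, the block sum the n-free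
`(1 + 4∕δG)²·K₄(δG∕2)` — so the row is `|ωgh·cK·cQ|·(CG n)²·n⁻⁶ × 2(1+4∕δG)²K₄(δG∕2)`: TOLERANCE n⁶.

CONTENT (all [folklore]; `B = B6QGQLower276.B (n − 1)`, `blk = blk (n − 1)`, block side `n`).  §1 lattice bookkeeping: `abs_toReal_sub_le_dist`, `dist_le_blk`,
`abs_weight_le` (`|w_μ·w_ν| ≤ (n·(dist (blk (b+w)) (blk b) + 1))²`), `sq_mul_exp_le`, **`sum_le_of_blockDecay`** (block decay ⟹ finite sums `≤ n⁴·c·K₄(δ)`),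
**`tsum_weight_le_of_blockDecay`** (`|f w| ≤ M·e^{−δ·dist(blk (b+w), blk b)}` ⟹ `Σ'_w |w_μ w_ν f w| ≤ M·(n²·(n⁴·((1+4∕δ)²·K₄(δ∕2))))`), the junction
**`abs_fullSum_weight_le_of_blockDecay`**.  §2 at the ghost leg under `hM` (constant `CG`, rate `δG`): `colMass_le`, **`abs_T₄_le`** ∕ **`abs_T₅_le`**
(`≤ 2·CG²·n⁻⁴·e^{−δG·dist}`), **`abs_row₄_le`** ∕ **`abs_row₅_le`**.  §3 in the glue's currency: **`h₄_of_blockMass_scaling`** ∕ **`h₅_of_blockMass_scaling`** — `hM` along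
`n` with `CG n`, fixed `0 < δG`, and `|ωgh n·(cK n·cQ n)|·(CG n)² ≤ k·n⁶` (resp. `cQ n·cK n`) ⊢ `h₄` ∕ `h₅` VERBATIM with `C := k·(2·((1+4∕δG)²·latticeConst 4 (δG∕2)))`.
Unit `b2b-balaban-gan24-formalise-leaf-05` (gen 41), G-an2-4 swarm leaf prover on cross-lane kernel duty; `LEAVES-BFx.md` row (N) ∕ (N-2) «NT-4»∕«NT-5» FILE B.
-/

noncomputable section

namespace Summit.QuantumFields.BalabanUV.Beta.D1BFx.NeedleGhostBubbleRow

open Finset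
open scoped BigOperators
open Literature.MathematicalPhysics.QuantumFieldTheory.Balaban1983to89
open Literature.MathematicalPhysics.QuantumFieldTheory.Balaban1983to89.Beta
open B4Sect5Proof (latticeConst latticeConst_nonneg latticeSum_le)
open B6QGQLower276 (X blk B mem_B U sum_U subset_U_image sum_B_const)
open ExpKernelCalculus (Site MKer)
open AffineAveraging (unitVec)
open DyadicShell (Pt toReal toReal_apply)
open WindowIdentification (fullSum fullSum_eq_tsum_sub)
open DressedMomentNormalisation (resSite)
open GhostStencil (ghCur)
open Summit.QuantumFields.BalabanUV.Beta.D1BFx.FineHessianSectors (biBubbleTable)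
open Summit.QuantumFields.BalabanUV.Beta.D1BFx.GhostStencilRooted (qAntiAt)
open Summit.QuantumFields.BalabanUV.Beta.D1BFx.GhostStencilRootedReflection (ctrHalf)
open Summit.QuantumFields.BalabanUV.Beta.D1BFx.GhostLeg (Ggh Ggh_symm cast_pred_add_one)
open Summit.QuantumFields.BalabanUV.Beta.D1BFx.RJetProjector (dist_le_side_mul_dist_blk)
open Summit.QuantumFields.BalabanUV.Beta.D1BFx.ContactCount (abs_sum_mul_le_of_convex)
open Summit.QuantumFields.BalabanUV.Beta.D1BFx.Assembly (sum_uniform_resSite uniform_resSite_nonneg)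
open Summit.QuantumFields.BalabanUV.Beta.D1BFx.NeedleGhostBubblePointwise (abs_biBubbleTable_ghCur_qAntiAt_le abs_biBubbleTable_qAntiAt_ghCur_le)
variable (n : ℕ) [NeZero n]

/-! ## §1 Lattice bookkeeping: (1.22) weights against block decay -/

omit [NeZero n] in
/-- [folklore] One coordinate of a difference is at most the sup distance: `|(p − b)_μ| ≤ dist p b`. -/
theorem abs_toReal_sub_le_dist (p b : Pt) (μ : Fin 4) : |toReal (p - b) μ| ≤ dist p b := by
  rw [toReal_apply, Pi.sub_apply, Int.cast_sub, ← Int.dist_eq]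
  exact dist_le_pi_dist p b μ

/-- [folklore] **FINE VS BLOCK DISTANCE** (blocks of side `n`): `dist p b ≤ n·(dist (blk p) (blk b) + 1)`. -/
theorem dist_le_blk (p b : Pt) : dist p b ≤ (n : ℝ) * (dist (blk (n - 1) p) (blk (n - 1) b) + 1) := by
  have h := dist_le_side_mul_dist_blk (n - 1) p b
  rw [cast_pred_add_one n] at h
  have h1 : ((n - 1 : ℕ) : ℝ) ≤ n := by exact_mod_cast Nat.sub_le n 1
  nlinarith [dist_nonneg (x := blk (n - 1) p) (y := blk (n - 1) b)]

/-- [folklore] **THE (1.22) WEIGHT AGAINST THE BLOCK SEPARATION**: `|w_μ·w_ν| ≤ (n·(dist (blk (b+w)) (blk b) + 1))²`. -/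
theorem abs_weight_le (b w : Pt) (μ ν : Fin 4) :
    |toReal w μ * toReal w ν| ≤ ((n : ℝ) * (dist (blk (n - 1) (b + w)) (blk (n - 1) b) + 1)) ^ 2 := by
  have e : w = (b + w) - b := by abel
  have hμ : |toReal w μ| ≤ (n : ℝ) * (dist (blk (n - 1) (b + w)) (blk (n - 1) b) + 1) := by
    conv_lhs => rw [e]
    exact (abs_toReal_sub_le_dist (b + w) b μ).trans (dist_le_blk n (b + w) b)
  have hν : |toReal w ν| ≤ (n : ℝ) * (dist (blk (n - 1) (b + w)) (blk (n - 1) b) + 1) := by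
    conv_lhs => rw [e]
    exact (abs_toReal_sub_le_dist (b + w) b ν).trans (dist_le_blk n (b + w) b)
  rw [abs_mul, sq]
  exact mul_le_mul hμ hν (abs_nonneg _) ((abs_nonneg _).trans hμ)

omit [NeZero n] in
/-- [folklore] Polynomial against exponential: `(k+1)²·e^{−δk} ≤ (1 + 4∕δ)²·e^{−(δ∕2)k}` for `k ≥ 0`, `δ > 0` (`Real.add_one_le_exp`). -/
theorem sq_mul_exp_le {δ : ℝ} (hδ : 0 < δ) {k : ℝ} (hk : 0 ≤ k) :
    (k + 1) ^ 2 * Real.exp (-(δ * k)) ≤ (1 + 4 / δ) ^ 2 * Real.exp (-(δ / 2 * k)) := by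
  have h1 : δ * k / 4 + 1 ≤ Real.exp (δ * k / 4) := Real.add_one_le_exp _
  have h2 : k + 1 ≤ (1 + 4 / δ) * Real.exp (δ * k / 4) := by
    have h3 : k + 1 ≤ (1 + 4 / δ) * (δ * k / 4 + 1) := by
      have e : (1 + 4 / δ) * (δ * k / 4 + 1) = k + 1 + (δ * k / 4 + 4 / δ) := by field_simp; ring
      rw [e]
      have : 0 ≤ δ * k / 4 + 4 / δ := by positivity
      linarith
    exact h3.trans (mul_le_mul_of_nonneg_left h1 (by positivity))
  have h4 : (k + 1) ^ 2 ≤ (1 + 4 / δ) ^ 2 * Real.exp (δ / 2 * k) := by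
    have h5 : 0 ≤ k + 1 := by linarith
    calc (k + 1) ^ 2 ≤ ((1 + 4 / δ) * Real.exp (δ * k / 4)) ^ 2 := pow_le_pow_left₀ h5 h2 2
      _ = (1 + 4 / δ) ^ 2 * (Real.exp (δ * k / 4) * Real.exp (δ * k / 4)) := by ring
      _ = (1 + 4 / δ) ^ 2 * Real.exp (δ / 2 * k) := by rw [← Real.exp_add]; ring_nf
  have e2 : (1 + 4 / δ) ^ 2 * Real.exp (-(δ / 2 * k)) = ((1 + 4 / δ) ^ 2 * Real.exp (δ / 2 * k)) * Real.exp (-(δ * k)) := by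
    rw [mul_assoc, ← Real.exp_add]; ring_nf
  rw [e2]
  exact mul_le_mul_of_nonneg_right h4 (Real.exp_pos _).le

omit [NeZero n] in
/-- [folklore] **A FINE-LATTICE FUNCTION WITH BLOCK DECAY HAS UNIFORMLY BOUNDED FINITE SUMS**: `0 ≤ h ≤ c·e^{−δ·dist(β₀, blk p)}` ⟹
`Σ_{p ∈ S} h p ≤ n⁴·(c·K₄(δ))` for every finite `S` (cover `S` by the blocks it meets, `n⁴` sites each, `B4Sect5Proof.latticeSum_le` on the labels). -/
theorem sum_le_of_blockDecay {h : Site 4 → ℝ} (hh0 : ∀ p, 0 ≤ h p) {c δ : ℝ} (hc : 0 ≤ c) (hδ : 0 < δ) (β₀ : Site 4)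
    (hh : ∀ p, h p ≤ c * Real.exp (-(δ * dist β₀ (blk (n - 1) p)))) (S : Finset (Site 4)) :
    ∑ p ∈ S, h p ≤ ((((n - 1 : ℕ) : ℝ) + 1) ^ 4) * (c * latticeConst 4 δ) := by
  classical
  calc ∑ p ∈ S, h p ≤ ∑ p ∈ U (n - 1) (S.image (blk (n - 1))), h p :=
        Finset.sum_le_sum_of_subset_of_nonneg (subset_U_image (n - 1) S) fun p _ _ => hh0 p
    _ = ∑ y ∈ S.image (blk (n - 1)), ∑ p ∈ B (n - 1) y, h p := sum_U _ _
    _ ≤ ∑ y ∈ S.image (blk (n - 1)), ∑ _p ∈ B (n - 1) y, c * Real.exp (-(δ * dist β₀ y)) := by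
        refine Finset.sum_le_sum fun y _ => Finset.sum_le_sum fun p hp => ?_
        have h1 := hh p
        rwa [mem_B.1 hp] at h1
    _ = ((((n - 1 : ℕ) : ℝ) + 1) ^ 4) * (c * ∑ y ∈ S.image (blk (n - 1)), Real.exp (-(δ * dist β₀ y))) := by
        rw [Finset.mul_sum, Finset.mul_sum]
        exact Finset.sum_congr rfl fun y _ => by rw [sum_B_const]
    _ ≤ ((((n - 1 : ℕ) : ℝ) + 1) ^ 4) * (c * latticeConst 4 δ) :=
        mul_le_mul_of_nonneg_left (mul_le_mul_of_nonneg_left (latticeSum_le 4 hδ _ β₀) hc) (by positivity)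

/-- [folklore] **THE WEIGHTED `w`-SUM AGAINST BLOCK DECAY**: if `|f w| ≤ M·e^{−δ·dist(blk (b+w), blk b)}` (`M ≥ 0`, `δ > 0`) then
`w ↦ |w_μ·w_ν·f w|` is summable and `Σ'_w |w_μ·w_ν·f w| ≤ M·(n²·(n⁴·((1 + 4∕δ)²·K₄(δ∕2))))`. -/
theorem tsum_weight_le_of_blockDecay {f : Pt → ℝ} {M δ : ℝ} (hM : 0 ≤ M) (hδ : 0 < δ) (b : Pt) (μ ν : Fin 4)
    (hf : ∀ w : Pt, |f w| ≤ M * Real.exp (-(δ * dist (blk (n - 1) (b + w)) (blk (n - 1) b)))) :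
    Summable (fun w : Pt => |toReal w μ * toReal w ν * f w|) ∧
      ∑' w : Pt, |toReal w μ * toReal w ν * f w| ≤ M * ((n : ℝ) ^ 2 * ((n : ℝ) ^ 4 * ((1 + 4 / δ) ^ 2 * latticeConst 4 (δ / 2)))) := by
  have hn : (0 : ℝ) < n := Nat.cast_pos.mpr (Nat.pos_of_ne_zero (NeZero.ne n))
  -- pointwise domination by a block-decaying function of `p = b + w`
  set c : ℝ := M * ((n : ℝ) ^ 2 * (1 + 4 / δ) ^ 2) with hc
  have hc0 : 0 ≤ c := by positivity
  have hdom : ∀ w : Pt, |toReal w μ * toReal w ν * f w| ≤ c * Real.exp (-(δ / 2 * dist (blk (n - 1) b) (blk (n - 1) (b + w)))) := by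
    intro w
    set k : ℝ := dist (blk (n - 1) (b + w)) (blk (n - 1) b) with hk
    have hk0 : 0 ≤ k := dist_nonneg
    have h1 := abs_weight_le n b w μ ν
    have h2 := hf w
    have h3 := sq_mul_exp_le hδ hk0
    rw [abs_mul]
    calc |toReal w μ * toReal w ν| * |f w| ≤ ((n : ℝ) * (k + 1)) ^ 2 * (M * Real.exp (-(δ * k))) :=
          mul_le_mul h1 h2 (abs_nonneg _) (by positivity)
      _ = M * (n : ℝ) ^ 2 * ((k + 1) ^ 2 * Real.exp (-(δ * k))) := by ring
      _ ≤ M * (n : ℝ) ^ 2 * ((1 + 4 / δ) ^ 2 * Real.exp (-(δ / 2 * k))) := mul_le_mul_of_nonneg_left h3 (by positivity)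
      _ = c * Real.exp (-(δ / 2 * dist (blk (n - 1) b) (blk (n - 1) (b + w)))) := by rw [hc, hk, dist_comm]; ring
  -- finite sums in `w` are finite sums in `p = b + w`
  have hfin : ∀ S : Finset Pt, ∑ w ∈ S, |toReal w μ * toReal w ν * f w| ≤
      M * ((n : ℝ) ^ 2 * ((n : ℝ) ^ 4 * ((1 + 4 / δ) ^ 2 * latticeConst 4 (δ / 2)))) := by
    intro S
    have h1 : ∑ w ∈ S, |toReal w μ * toReal w ν * f w| ≤ ∑ w ∈ S, c * Real.exp (-(δ / 2 * dist (blk (n - 1) b) (blk (n - 1) (b + w)))) :=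
      Finset.sum_le_sum fun w _ => hdom w
    have h2 : ∑ w ∈ S, c * Real.exp (-(δ / 2 * dist (blk (n - 1) b) (blk (n - 1) (b + w))))
        = ∑ p ∈ S.map (addLeftEmbedding b), c * Real.exp (-(δ / 2 * dist (blk (n - 1) b) (blk (n - 1) p))) := by
      rw [Finset.sum_map]
      rfl
    have h3 := sum_le_of_blockDecay n (h := fun p => c * Real.exp (-(δ / 2 * dist (blk (n - 1) b) (blk (n - 1) p))))
      (fun p => by positivity) hc0 (half_pos hδ) (blk (n - 1) b) (fun p => le_rfl) (S.map (addLeftEmbedding b))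
    rw [cast_pred_add_one n] at h3
    calc ∑ w ∈ S, |toReal w μ * toReal w ν * f w| ≤ (n : ℝ) ^ 4 * (c * latticeConst 4 (δ / 2)) := by rw [h2] at h1; exact h1.trans h3
      _ = M * ((n : ℝ) ^ 2 * ((n : ℝ) ^ 4 * ((1 + 4 / δ) ^ 2 * latticeConst 4 (δ / 2)))) := by rw [hc]; ring
  have hsum : Summable (fun w : Pt => |toReal w μ * toReal w ν * f w|) := summable_of_sum_le (fun w => abs_nonneg _) hfin
  exact ⟨hsum, hsum.tsum_le_of_sum_le hfin⟩

/-- [folklore] **THE JUNCTION**: under the same domination the punctured full sum of the (1.22) integrand is bounded by the same constant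
(`WindowIdentification.fullSum_eq_tsum_sub`: the origin carries weight `0`). -/
theorem abs_fullSum_weight_le_of_blockDecay {f : Pt → ℝ} {M δ : ℝ} (hM : 0 ≤ M) (hδ : 0 < δ) (b : Pt) (μ ν : Fin 4)
    (hf : ∀ w : Pt, |f w| ≤ M * Real.exp (-(δ * dist (blk (n - 1) (b + w)) (blk (n - 1) b)))) :
    |fullSum (fun w : Pt => toReal w μ * toReal w ν * f w)| ≤ M * ((n : ℝ) ^ 2 * ((n : ℝ) ^ 4 * ((1 + 4 / δ) ^ 2 * latticeConst 4 (δ / 2)))) := by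
  obtain ⟨hs, hle⟩ := tsum_weight_le_of_blockDecay n hM hδ b μ ν hf
  have hs' : Summable (fun w : Pt => toReal w μ * toReal w ν * f w) := hs.of_abs
  rw [fullSum_eq_tsum_sub _ hs']
  have h0 : toReal (0 : Pt) μ * toReal (0 : Pt) ν * f 0 = 0 := by simp [toReal_apply]
  rw [h0, sub_zero]
  have h1 : ‖∑' w : Pt, toReal w μ * toReal w ν * f w‖ ≤ ∑' w : Pt, ‖toReal w μ * toReal w ν * f w‖ := norm_tsum_le_tsum_norm hs
  simpa only [Real.norm_eq_abs] using h1.trans hle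

/-! ## §2 At the ghost leg, fixed block size, under the block-row mass letter -/

section Ghost

variable (a : ℝ) {CG δG : ℝ}

/-- [folklore] Under the block-ROW mass letter the block-COLUMN masses obey the same bound (`GhostLeg.Ggh_symm`). -/
theorem colMass_le (ha : 0 < a) (hM : ∀ y β : Site 4, ∑ t ∈ B (n - 1) β, |Ggh n a y t () ()| ≤ CG * Real.exp (-(δG * dist (blk (n - 1) y) β)))
    (y β : Site 4) : ∑ x ∈ B (n - 1) β, |Ggh n a x y () ()| ≤ CG * Real.exp (-(δG * dist (blk (n - 1) y) β)) := by
  have e : ∑ x ∈ B (n - 1) β, |Ggh n a x y () ()| = ∑ x ∈ B (n - 1) β, |Ggh n a y x () ()| :=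
    Finset.sum_congr rfl fun x _ => by rw [Ggh_symm n a ha x y () ()]
  rw [e]; exact hM y β

/-- [folklore] The letter's constant is non-negative. -/
theorem CG_nonneg (hM : ∀ y β : Site 4, ∑ t ∈ B (n - 1) β, |Ggh n a y t () ()| ≤ CG * Real.exp (-(δG * dist (blk (n - 1) y) β))) : 0 ≤ CG := by
  have h := hM 0 (blk (n - 1) 0); rw [dist_self, mul_zero, neg_zero, Real.exp_zero, mul_one] at h
  exact (Finset.sum_nonneg fun _ _ => abs_nonneg _).trans h

/-- [folklore] **THE POINTWISE BOUND OF `T₄ = ghCur ⊗ qA` UNDER THE LETTER**: `|T₄(b+w, b)| ≤ 2·CG²·n⁻⁴·e^{−δG·dist(blk (b+w), blk b)}` (FILE A's letter with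
the block masses at the needle's block `B(blk b)`; the factors at `b+w+e_μ` are bounded by `CG` outright). -/
theorem abs_T₄_le (ha : 0 < a) (hδG : 0 < δG)
    (hM : ∀ y β : Site 4, ∑ t ∈ B (n - 1) β, |Ggh n a y t () ()| ≤ CG * Real.exp (-(δG * dist (blk (n - 1) y) β)))
    (ρ : Site 4) (μ ν : Fin 4) (b w : Pt) :
    |biBubbleTable (Ggh n a) (Ggh n a) ghCur (qAntiAt ρ n) μ ν (b + w) b|
      ≤ 2 * CG ^ 2 * ((n : ℝ) ^ 4)⁻¹ * Real.exp (-(δG * dist (blk (n - 1) (b + w)) (blk (n - 1) b))) := by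
  have hn : (0 : ℝ) < n := Nat.cast_pos.mpr (Nat.pos_of_ne_zero (NeZero.ne n))
  have hw : (0 : ℝ) ≤ ((n : ℝ) ^ 4)⁻¹ := inv_nonneg.mpr (pow_pos hn 4).le
  have hCG := CG_nonneg n a hM
  set E := Real.exp (-(δG * dist (blk (n - 1) (b + w)) (blk (n - 1) b))) with hE
  have hE0 : 0 ≤ E := (Real.exp_pos _).le
  have h0 := abs_biBubbleTable_ghCur_qAntiAt_le ρ n ν b (Ggh n a) (Ggh n a) μ (b + w)
  -- the four masses
  have hr1 : ∑ t ∈ B (n - 1) (blk (n - 1) b), |Ggh n a (b + w) t () ()| ≤ CG * E := hM (b + w) (blk (n - 1) b)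
  have hr2 : ∑ t ∈ B (n - 1) (blk (n - 1) b), |Ggh n a (b + w + unitVec μ) t () ()| ≤ CG := by
    refine (hM (b + w + unitVec μ) (blk (n - 1) b)).trans ?_
    exact mul_le_of_le_one_right hCG (Real.exp_le_one_iff.2 (by nlinarith [dist_nonneg (x := blk (n - 1) (b + w + unitVec μ)) (y := blk (n - 1) b)]))
  have hc1 : ∑ x ∈ B (n - 1) (blk (n - 1) b), |Ggh n a x (b + w) () ()| ≤ CG * E := colMass_le n a ha hM (b + w) (blk (n - 1) b)
  have hc2 : ∑ x ∈ B (n - 1) (blk (n - 1) b), |Ggh n a x (b + w + unitVec μ) () ()| ≤ CG := by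
    refine (colMass_le n a ha hM (b + w + unitVec μ) (blk (n - 1) b)).trans ?_
    exact mul_le_of_le_one_right hCG (Real.exp_le_one_iff.2 (by nlinarith [dist_nonneg (x := blk (n - 1) (b + w + unitVec μ)) (y := blk (n - 1) b)]))
  have hm2 : 0 ≤ ∑ x ∈ B (n - 1) (blk (n - 1) b), |Ggh n a x (b + w + unitVec μ) () ()| := Finset.sum_nonneg fun _ _ => abs_nonneg _
  have hm3 : 0 ≤ ∑ x ∈ B (n - 1) (blk (n - 1) b), |Ggh n a x (b + w) () ()| := Finset.sum_nonneg fun _ _ => abs_nonneg _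
  refine h0.trans ?_
  have hP : (∑ t ∈ B (n - 1) (blk (n - 1) b), |Ggh n a (b + w) t () ()|) * (∑ x ∈ B (n - 1) (blk (n - 1) b), |Ggh n a x (b + w + unitVec μ) () ()|)
      + (∑ t ∈ B (n - 1) (blk (n - 1) b), |Ggh n a (b + w + unitVec μ) t () ()|) * (∑ x ∈ B (n - 1) (blk (n - 1) b), |Ggh n a x (b + w) () ()|)
      ≤ CG * E * CG + CG * (CG * E) :=
    add_le_add (mul_le_mul hr1 hc2 hm2 (by positivity)) (mul_le_mul hr2 hc1 hm3 hCG)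
  calc ((n : ℝ) ^ 4)⁻¹ * _ ≤ ((n : ℝ) ^ 4)⁻¹ * (CG * E * CG + CG * (CG * E)) := mul_le_mul_of_nonneg_left hP hw
    _ = 2 * CG ^ 2 * ((n : ℝ) ^ 4)⁻¹ * E := by ring

/-- [folklore] **THE POINTWISE BOUND OF `T₅ = qA ⊗ ghCur` UNDER THE LETTER**: `|T₅(b+w, b)| ≤ 2·CG²·n⁻⁴·e^{−δG·dist(blk (b+w), blk b)}` (needle at the
running bond `b+w`, current at `b`: block masses at `B(blk (b+w))`). -/
theorem abs_T₅_le (ha : 0 < a) (hδG : 0 < δG)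
    (hM : ∀ y β : Site 4, ∑ t ∈ B (n - 1) β, |Ggh n a y t () ()| ≤ CG * Real.exp (-(δG * dist (blk (n - 1) y) β)))
    (ρ : Site 4) (μ ν : Fin 4) (b w : Pt) :
    |biBubbleTable (Ggh n a) (Ggh n a) (qAntiAt ρ n) ghCur μ ν (b + w) b|
      ≤ 2 * CG ^ 2 * ((n : ℝ) ^ 4)⁻¹ * Real.exp (-(δG * dist (blk (n - 1) (b + w)) (blk (n - 1) b))) := by
  have hn : (0 : ℝ) < n := Nat.cast_pos.mpr (Nat.pos_of_ne_zero (NeZero.ne n))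
  have hw : (0 : ℝ) ≤ ((n : ℝ) ^ 4)⁻¹ := inv_nonneg.mpr (pow_pos hn 4).le
  have hCG := CG_nonneg n a hM
  set E := Real.exp (-(δG * dist (blk (n - 1) (b + w)) (blk (n - 1) b))) with hE
  have hE0 : 0 ≤ E := (Real.exp_pos _).le
  have h0 := abs_biBubbleTable_qAntiAt_ghCur_le ρ n μ (b + w) (Ggh n a) (Ggh n a) ν b
  have hEsym : Real.exp (-(δG * dist (blk (n - 1) b) (blk (n - 1) (b + w)))) = E := by rw [hE, dist_comm]
  have hr1 : ∑ t ∈ B (n - 1) (blk (n - 1) (b + w)), |Ggh n a b t () ()| ≤ CG * E := by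
    have h := hM b (blk (n - 1) (b + w)); rwa [hEsym] at h
  have hr2 : ∑ t ∈ B (n - 1) (blk (n - 1) (b + w)), |Ggh n a (b + unitVec ν) t () ()| ≤ CG := by
    refine (hM (b + unitVec ν) (blk (n - 1) (b + w))).trans ?_
    exact mul_le_of_le_one_right hCG (Real.exp_le_one_iff.2 (by nlinarith [dist_nonneg (x := blk (n - 1) (b + unitVec ν)) (y := blk (n - 1) (b + w))]))
  have hc1 : ∑ z ∈ B (n - 1) (blk (n - 1) (b + w)), |Ggh n a z b () ()| ≤ CG * E := by
    have h := colMass_le n a ha hM b (blk (n - 1) (b + w)); rwa [hEsym] at h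
  have hc2 : ∑ z ∈ B (n - 1) (blk (n - 1) (b + w)), |Ggh n a z (b + unitVec ν) () ()| ≤ CG := by
    refine (colMass_le n a ha hM (b + unitVec ν) (blk (n - 1) (b + w))).trans ?_
    exact mul_le_of_le_one_right hCG (Real.exp_le_one_iff.2 (by nlinarith [dist_nonneg (x := blk (n - 1) (b + unitVec ν)) (y := blk (n - 1) (b + w))]))
  have hm2 : 0 ≤ ∑ z ∈ B (n - 1) (blk (n - 1) (b + w)), |Ggh n a z (b + unitVec ν) () ()| := Finset.sum_nonneg fun _ _ => abs_nonneg _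
  have hm3 : 0 ≤ ∑ z ∈ B (n - 1) (blk (n - 1) (b + w)), |Ggh n a z b () ()| := Finset.sum_nonneg fun _ _ => abs_nonneg _
  refine h0.trans ?_
  have hP : (∑ t ∈ B (n - 1) (blk (n - 1) (b + w)), |Ggh n a b t () ()|) * (∑ z ∈ B (n - 1) (blk (n - 1) (b + w)), |Ggh n a z (b + unitVec ν) () ()|)
      + (∑ t ∈ B (n - 1) (blk (n - 1) (b + w)), |Ggh n a (b + unitVec ν) t () ()|) * (∑ z ∈ B (n - 1) (blk (n - 1) (b + w)), |Ggh n a z b () ()|)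
      ≤ CG * E * CG + CG * (CG * E) :=
    add_le_add (mul_le_mul hr1 hc2 hm2 (by positivity)) (mul_le_mul hr2 hc1 hm3 hCG)
  calc ((n : ℝ) ^ 4)⁻¹ * _ ≤ ((n : ℝ) ^ 4)⁻¹ * (CG * E * CG + CG * (CG * E)) := mul_le_mul_of_nonneg_left hP hw
    _ = 2 * CG ^ 2 * ((n : ℝ) ^ 4)⁻¹ * E := by ring

/-- [folklore] **THE ROW OF `T₄` AT FIXED `n`, BASE-POINT AVERAGED**, for any scalar prefactor `c`:
`|c·Σ_{b ∈ image resSite} n⁻⁴·(n⁻⁸·fullSum (w ↦ w_μw_ν·T₄(b+w,b)))| ≤ |c|·CG²·((n⁸)⁻¹·((n⁴)⁻¹·(n²·n⁴)))·(2·((1+4∕δG)²·K₄(δG∕2)))`. -/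
theorem abs_row₄_le (ha : 0 < a) (hδG : 0 < δG)
    (hM : ∀ y β : Site 4, ∑ t ∈ B (n - 1) β, |Ggh n a y t () ()| ≤ CG * Real.exp (-(δG * dist (blk (n - 1) y) β)))
    (ρ : Site 4) (c : ℝ) (μ ν : Fin 4) :
    |c * ∑ b ∈ (univ : Finset (Fin 4 → Fin n)).image resSite, ((n : ℝ) ^ 4)⁻¹ * (((n : ℝ) ^ 8)⁻¹ *
        fullSum (fun w : Pt => toReal w μ * toReal w ν * biBubbleTable (Ggh n a) (Ggh n a) ghCur (qAntiAt ρ n) μ ν (b + w) b))|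
      ≤ |c| * CG ^ 2 * ((((n : ℝ) ^ 8)⁻¹ * (((n : ℝ) ^ 4)⁻¹ * ((n : ℝ) ^ 2 * (n : ℝ) ^ 4))) * (2 * ((1 + 4 / δG) ^ 2 * latticeConst 4 (δG / 2)))) := by
  have hn : (0 : ℝ) < n := Nat.cast_pos.mpr (Nat.pos_of_ne_zero (NeZero.ne n))
  have hCG := CG_nonneg n a hM
  have hMM : 0 ≤ 2 * CG ^ 2 * ((n : ℝ) ^ 4)⁻¹ := by positivity
  have hword : ∀ b : Pt, |fullSum (fun w : Pt => toReal w μ * toReal w ν * biBubbleTable (Ggh n a) (Ggh n a) ghCur (qAntiAt ρ n) μ ν (b + w) b)|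
      ≤ 2 * CG ^ 2 * ((n : ℝ) ^ 4)⁻¹ * ((n : ℝ) ^ 2 * ((n : ℝ) ^ 4 * ((1 + 4 / δG) ^ 2 * latticeConst 4 (δG / 2)))) := fun b =>
    abs_fullSum_weight_le_of_blockDecay n hMM hδG b μ ν (fun w => abs_T₄_le n a ha hδG hM ρ μ ν b w)
  have hT : 0 ≤ 2 * CG ^ 2 * ((n : ℝ) ^ 4)⁻¹ * ((n : ℝ) ^ 2 * ((n : ℝ) ^ 4 * ((1 + 4 / δG) ^ 2 * latticeConst 4 (δG / 2)))) :=
    (abs_nonneg _).trans (hword 0)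
  rw [abs_mul]
  have havg : |∑ b ∈ (univ : Finset (Fin 4 → Fin n)).image resSite, ((n : ℝ) ^ 4)⁻¹ * (((n : ℝ) ^ 8)⁻¹ *
        fullSum (fun w : Pt => toReal w μ * toReal w ν * biBubbleTable (Ggh n a) (Ggh n a) ghCur (qAntiAt ρ n) μ ν (b + w) b))|
      ≤ ((n : ℝ) ^ 8)⁻¹ * (2 * CG ^ 2 * ((n : ℝ) ^ 4)⁻¹ * ((n : ℝ) ^ 2 * ((n : ℝ) ^ 4 * ((1 + 4 / δG) ^ 2 * latticeConst 4 (δG / 2))))) := by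
    refine abs_sum_mul_le_of_convex _ (fun b hb => uniform_resSite_nonneg n b hb) (sum_uniform_resSite (NeZero.ne n)) fun b _ => ?_
    rw [abs_mul, abs_of_nonneg (by positivity : (0 : ℝ) ≤ ((n : ℝ) ^ 8)⁻¹)]
    exact mul_le_mul_of_nonneg_left (hword b) (by positivity)
  calc |c| * |∑ b ∈ (univ : Finset (Fin 4 → Fin n)).image resSite, ((n : ℝ) ^ 4)⁻¹ * (((n : ℝ) ^ 8)⁻¹ *
        fullSum (fun w : Pt => toReal w μ * toReal w ν * biBubbleTable (Ggh n a) (Ggh n a) ghCur (qAntiAt ρ n) μ ν (b + w) b))|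
      ≤ |c| * (((n : ℝ) ^ 8)⁻¹ * (2 * CG ^ 2 * ((n : ℝ) ^ 4)⁻¹ * ((n : ℝ) ^ 2 * ((n : ℝ) ^ 4 * ((1 + 4 / δG) ^ 2 * latticeConst 4 (δG / 2)))))) :=
        mul_le_mul_of_nonneg_left havg (abs_nonneg c)
    _ = _ := by ring

/-- [folklore] **THE ROW OF `T₅` AT FIXED `n`, BASE-POINT AVERAGED** — the same bound. -/
theorem abs_row₅_le (ha : 0 < a) (hδG : 0 < δG)
    (hM : ∀ y β : Site 4, ∑ t ∈ B (n - 1) β, |Ggh n a y t () ()| ≤ CG * Real.exp (-(δG * dist (blk (n - 1) y) β)))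
    (ρ : Site 4) (c : ℝ) (μ ν : Fin 4) :
    |c * ∑ b ∈ (univ : Finset (Fin 4 → Fin n)).image resSite, ((n : ℝ) ^ 4)⁻¹ * (((n : ℝ) ^ 8)⁻¹ *
        fullSum (fun w : Pt => toReal w μ * toReal w ν * biBubbleTable (Ggh n a) (Ggh n a) (qAntiAt ρ n) ghCur μ ν (b + w) b))|
      ≤ |c| * CG ^ 2 * ((((n : ℝ) ^ 8)⁻¹ * (((n : ℝ) ^ 4)⁻¹ * ((n : ℝ) ^ 2 * (n : ℝ) ^ 4))) * (2 * ((1 + 4 / δG) ^ 2 * latticeConst 4 (δG / 2)))) := by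
  have hn : (0 : ℝ) < n := Nat.cast_pos.mpr (Nat.pos_of_ne_zero (NeZero.ne n))
  have hCG := CG_nonneg n a hM
  have hMM : 0 ≤ 2 * CG ^ 2 * ((n : ℝ) ^ 4)⁻¹ := by positivity
  have hword : ∀ b : Pt, |fullSum (fun w : Pt => toReal w μ * toReal w ν * biBubbleTable (Ggh n a) (Ggh n a) (qAntiAt ρ n) ghCur μ ν (b + w) b)|
      ≤ 2 * CG ^ 2 * ((n : ℝ) ^ 4)⁻¹ * ((n : ℝ) ^ 2 * ((n : ℝ) ^ 4 * ((1 + 4 / δG) ^ 2 * latticeConst 4 (δG / 2)))) := fun b =>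
    abs_fullSum_weight_le_of_blockDecay n hMM hδG b μ ν (fun w => abs_T₅_le n a ha hδG hM ρ μ ν b w)
  have hT : 0 ≤ 2 * CG ^ 2 * ((n : ℝ) ^ 4)⁻¹ * ((n : ℝ) ^ 2 * ((n : ℝ) ^ 4 * ((1 + 4 / δG) ^ 2 * latticeConst 4 (δG / 2)))) :=
    (abs_nonneg _).trans (hword 0)
  rw [abs_mul]
  have havg : |∑ b ∈ (univ : Finset (Fin 4 → Fin n)).image resSite, ((n : ℝ) ^ 4)⁻¹ * (((n : ℝ) ^ 8)⁻¹ *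
        fullSum (fun w : Pt => toReal w μ * toReal w ν * biBubbleTable (Ggh n a) (Ggh n a) (qAntiAt ρ n) ghCur μ ν (b + w) b))|
      ≤ ((n : ℝ) ^ 8)⁻¹ * (2 * CG ^ 2 * ((n : ℝ) ^ 4)⁻¹ * ((n : ℝ) ^ 2 * ((n : ℝ) ^ 4 * ((1 + 4 / δG) ^ 2 * latticeConst 4 (δG / 2))))) := by
    refine abs_sum_mul_le_of_convex _ (fun b hb => uniform_resSite_nonneg n b hb) (sum_uniform_resSite (NeZero.ne n)) fun b _ => ?_
    rw [abs_mul, abs_of_nonneg (by positivity : (0 : ℝ) ≤ ((n : ℝ) ^ 8)⁻¹)]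
    exact mul_le_mul_of_nonneg_left (hword b) (by positivity)
  calc |c| * |∑ b ∈ (univ : Finset (Fin 4 → Fin n)).image resSite, ((n : ℝ) ^ 4)⁻¹ * (((n : ℝ) ^ 8)⁻¹ *
        fullSum (fun w : Pt => toReal w μ * toReal w ν * biBubbleTable (Ggh n a) (Ggh n a) (qAntiAt ρ n) ghCur μ ν (b + w) b))|
      ≤ |c| * (((n : ℝ) ^ 8)⁻¹ * (2 * CG ^ 2 * ((n : ℝ) ^ 4)⁻¹ * ((n : ℝ) ^ 2 * ((n : ℝ) ^ 4 * ((1 + 4 / δG) ^ 2 * latticeConst 4 (δG / 2)))))) :=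
        mul_le_mul_of_nonneg_left havg (abs_nonneg c)
    _ = _ := by ring

end Ghost

/-! ## §3 In the glue's currency: `h₄` and `h₅` from the block-mass letter + ONE scaling inequality (tolerance `n⁶`) -/

section Glue

variable {a : ℝ} {ωgh cK cQ CG : ℕ → ℝ} {δG k : ℝ}

/-- [folklore] **«NT-4»: THE GHOST BUBBLE ROW `h₄` (`ghCur ⊗ qA`) OF THE NEEDLE GROUP** from the DISPLAYED block-row mass letter of the ghost leg along
the block sizes (`CG n`, fixed rate `δG > 0`; the located M10 currency — not ruled here) and the scaling letter `|ωgh n·(cK n·cQ n)|·(CG n)² ≤ k·n⁶`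
(`n ≥ 2`): `h₄` of `NeedleRowGlue.abs_gN_row_le_of_tables` VERBATIM with `C₄ := k·(2·((1 + 4∕δG)²·latticeConst 4 (δG∕2)))` — TOLERANCE `n⁶`. -/
theorem h₄_of_blockMass_scaling (ha : 0 < a) (hδG : 0 < δG)
    (hM : ∀ (n : ℕ) [NeZero n] (y β : Site 4),
      ∑ t ∈ B (n - 1) β, |Ggh n a y t () ()| ≤ CG n * Real.exp (-(δG * dist (blk (n - 1) y) β)))
    (hk : ∀ n : ℕ, 2 ≤ n → |ωgh n * (cK n * cQ n)| * (CG n) ^ 2 ≤ k * (n : ℝ) ^ 6) (μ ν : Fin 4) :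
    ∀ n : ℕ, 2 ≤ n → ∀ [NeZero n], |ωgh n * (cK n * cQ n) * ∑ b ∈ (univ : Finset (Fin 4 → Fin n)).image resSite, ((n : ℝ) ^ 4)⁻¹ *
      (((n : ℝ) ^ 8)⁻¹ * fullSum (fun w : Pt => toReal w μ * toReal w ν *
        biBubbleTable (Ggh n a) (Ggh n a) ghCur (qAntiAt (ctrHalf n) n) μ ν (b + w) b))|
        ≤ k * (2 * ((1 + 4 / δG) ^ 2 * latticeConst 4 (δG / 2))) := by
  intro n hn _
  have hn0 : (0 : ℝ) < n := by exact_mod_cast (show 0 < n by omega)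
  have h1 := abs_row₄_le n a ha hδG (hM n) (ctrHalf n) (ωgh n * (cK n * cQ n)) μ ν
  have hK : 0 ≤ 2 * ((1 + 4 / δG) ^ 2 * latticeConst 4 (δG / 2)) := by
    have := latticeConst_nonneg 4 (half_pos hδG).le; positivity
  have e : ((n : ℝ) ^ 8)⁻¹ * (((n : ℝ) ^ 4)⁻¹ * ((n : ℝ) ^ 2 * (n : ℝ) ^ 4)) = ((n : ℝ) ^ 6)⁻¹ := by
    field_simp
  rw [e] at h1
  refine h1.trans ?_
  have h2 : |ωgh n * (cK n * cQ n)| * CG n ^ 2 * ((n : ℝ) ^ 6)⁻¹ ≤ k := by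
    rw [← le_div_iff₀ (inv_pos.2 (pow_pos hn0 6)), div_inv_eq_mul]
    exact hk n hn
  calc |ωgh n * (cK n * cQ n)| * CG n ^ 2 * (((n : ℝ) ^ 6)⁻¹ * (2 * ((1 + 4 / δG) ^ 2 * latticeConst 4 (δG / 2))))
      = (|ωgh n * (cK n * cQ n)| * CG n ^ 2 * ((n : ℝ) ^ 6)⁻¹) * (2 * ((1 + 4 / δG) ^ 2 * latticeConst 4 (δG / 2))) := by ring
    _ ≤ k * (2 * ((1 + 4 / δG) ^ 2 * latticeConst 4 (δG / 2))) := mul_le_mul_of_nonneg_right h2 hK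

/-- [folklore] **«NT-5»: THE GHOST BUBBLE ROW `h₅` (`qA ⊗ ghCur`) OF THE NEEDLE GROUP** — the same letter and the scaling
`|ωgh n·(cQ n·cK n)|·(CG n)² ≤ k·n⁶` give `h₅` of `NeedleRowGlue.abs_gN_row_le_of_tables` VERBATIM with `C₅ := k·(2·((1 + 4∕δG)²·latticeConst 4 (δG∕2)))`. -/
theorem h₅_of_blockMass_scaling (ha : 0 < a) (hδG : 0 < δG)
    (hM : ∀ (n : ℕ) [NeZero n] (y β : Site 4),
      ∑ t ∈ B (n - 1) β, |Ggh n a y t () ()| ≤ CG n * Real.exp (-(δG * dist (blk (n - 1) y) β)))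
    (hk : ∀ n : ℕ, 2 ≤ n → |ωgh n * (cQ n * cK n)| * (CG n) ^ 2 ≤ k * (n : ℝ) ^ 6) (μ ν : Fin 4) :
    ∀ n : ℕ, 2 ≤ n → ∀ [NeZero n], |ωgh n * (cQ n * cK n) * ∑ b ∈ (univ : Finset (Fin 4 → Fin n)).image resSite, ((n : ℝ) ^ 4)⁻¹ *
      (((n : ℝ) ^ 8)⁻¹ * fullSum (fun w : Pt => toReal w μ * toReal w ν *
        biBubbleTable (Ggh n a) (Ggh n a) (qAntiAt (ctrHalf n) n) ghCur μ ν (b + w) b))|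
        ≤ k * (2 * ((1 + 4 / δG) ^ 2 * latticeConst 4 (δG / 2))) := by
  intro n hn _
  have hn0 : (0 : ℝ) < n := by exact_mod_cast (show 0 < n by omega)
  have h1 := abs_row₅_le n a ha hδG (hM n) (ctrHalf n) (ωgh n * (cQ n * cK n)) μ ν
  have hK : 0 ≤ 2 * ((1 + 4 / δG) ^ 2 * latticeConst 4 (δG / 2)) := by
    have := latticeConst_nonneg 4 (half_pos hδG).le; positivity
  have e : ((n : ℝ) ^ 8)⁻¹ * (((n : ℝ) ^ 4)⁻¹ * ((n : ℝ) ^ 2 * (n : ℝ) ^ 4)) = ((n : ℝ) ^ 6)⁻¹ := by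
    field_simp
  rw [e] at h1
  refine h1.trans ?_
  have h2 : |ωgh n * (cQ n * cK n)| * CG n ^ 2 * ((n : ℝ) ^ 6)⁻¹ ≤ k := by
    rw [← le_div_iff₀ (inv_pos.2 (pow_pos hn0 6)), div_inv_eq_mul]
    exact hk n hn
  calc |ωgh n * (cQ n * cK n)| * CG n ^ 2 * (((n : ℝ) ^ 6)⁻¹ * (2 * ((1 + 4 / δG) ^ 2 * latticeConst 4 (δG / 2))))
      = (|ωgh n * (cQ n * cK n)| * CG n ^ 2 * ((n : ℝ) ^ 6)⁻¹) * (2 * ((1 + 4 / δG) ^ 2 * latticeConst 4 (δG / 2))) := by ring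
    _ ≤ k * (2 * ((1 + 4 / δG) ^ 2 * latticeConst 4 (δG / 2))) := mul_le_mul_of_nonneg_right h2 hK

end Glue

end Summit.QuantumFields.BalabanUV.Beta.D1BFx.NeedleGhostBubbleRow
end
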